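import Literature.MathematicalPhysics.QuantumManyBody.BoseGasFreeDirichletBEC
import Literature.MathematicalPhysics.QuantumManyBody.DyadicCoherentFractionRefinement

/-!
# Route `BECDyadicChaining` — crux `BaseCoherentMass` (stmt-AtomisticToContinuum-13193), stub P

Block mass capture (Neumann–Poincaré in the dyadic cubes), the registered stub
`stub_blockMassCapture` of the line `registered` of the crux
`Summit.AtomisticToContinuum.BoseEinsteinCondensation.Theses.BECDyadicChaining.BaseCoherentMass`:
for every Dirichlet trial state `Ψ` of `N` bosons in the box `Λ_L` and every dyadic level `K`
(cube side `s = L/2^K`, flat modes `φ_B = dyMode L K B` of the `8^K` half-open dyadic cells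
`B = dyCell L K ·`),

`N ≤ Σ_B ⟨φ_B, γ_Ψ φ_B⟩ + (s²/π²) ∫ |∇Ψ|²`.

Proof: this is `key_inequality` of `BoseGasFreeDirichletBEC` (the sharp Neumann gap `π²/s²` of each
cube applied slice-wise in the first particle, summed over the `k³` sub-cells `subCell s q`, `k s = L`,
and multiplied by `N` through Bose symmetry) at `k = 2^K`, `s = L/2^K`, where the sub-cells and their
constant modes `subMode s q` are literally the dyadic cells and flat modes
(`blockMassCapture_subCell_eq_dyCell`, `blockMassCapture_subMode_eq_dyMode`), the free energy
`energy 0 Ψ` is the kinetic energy, and the inequality is divided by the gap `(π/s)²`.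
Degenerate cases: `N = 0` (left side `0`) and `L ≤ 0` (no Dirichlet trial state with `N ≥ 1`
exists, `blockMassCapture_side_pos`).

## References

* [LSSY2005] E. H. Lieb, R. Seiringer, J. P. Solovej, J. Yngvason, *The Mathematics of the Bose Gas
  and its Condensation* (2005), Ch. 5 (5.15)–(5.17) (Poincaré / gap method); §1.2 (1.17).
-/

noncomputable section

namespace Summit.AtomisticToContinuum.BoseEinsteinCondensation.Theorems.BaseCoherentMass

open MeasureTheory
open scoped ENNReal NNReal
open Literature.MathematicalPhysics.QuantumManyBody.BoseGas

/-- A Dirichlet trial state with at least one particle forces `0 < L`: for `L ≤ 0` the open box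
`Λ_L` is empty, so `Ψ ≡ 0`, contradicting `∫ |Ψ|² = 1`. [folklore] -/
theorem blockMassCapture_side_pos {n : ℕ} {L : ℝ} (Ψ : TrialState (n + 1) L) : 0 < L := by
  by_contra hL
  push Not at hL
  have hbox : ∀ X : Config (n + 1), X ∉ boxN (n + 1) L := by
    intro X hX
    have h0 : (X 0) 0 ∈ Set.Ioo 0 L := hX 0 0
    exact absurd (h0.1.trans h0.2) (not_lt.2 hL)
  have hzero : ∀ X, Ψ.ψ X = 0 := fun X => Ψ.eq_zero X (hbox X)
  have h := Ψ.norm_eq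
  simp [hzero] at h

/-- At side `s = L/2^K` the sub-cells `s q + [0,s)³` of `BoseGasFreeDirichletBEC` are the half-open
dyadic cells of level `K`. [folklore] -/
theorem blockMassCapture_subCell_eq_dyCell (L : ℝ) (K : ℕ) (q : Fin 3 → Fin (2 ^ K)) :
    subCell (L / 2 ^ K) q = dyCell L K q := by
  ext x
  rw [mem_subCell, mem_dyCell_iff]
  refine forall_congr' fun i => ?_
  rw [mul_comm (L / 2 ^ K), add_mul, one_mul]

/-- … hence the sub-cell constant modes are the dyadic flat modes. [folklore] -/
theorem blockMassCapture_subMode_eq_dyMode (L : ℝ) (K : ℕ) (q : Fin 3 → Fin (2 ^ K)) :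
    subMode (L / 2 ^ K) q = dyMode L K q := by
  rw [subMode_eq_indicator, blockMassCapture_subCell_eq_dyCell]
  rfl

/-- **Stub P — block mass capture (Neumann–Poincaré in the dyadic cubes).** For every Dirichlet trial
state `Ψ` of `N` bosons in the box of side `L` and every level `K` (cube side `s = L/2^K`):
`N ≤ Σ_B ⟨φ_B, γ_Ψ φ_B⟩ + (s²/π²) ∫ |∇Ψ|²` over the flat modes `dyMode L K ·` of the half-open dyadic
cells (the Neumann gap `π²/s²` of each cube, slice-wise in the first particle, Bose symmetry:
`key_inequality` of `BoseGasFreeDirichletBEC` multiplied by `(s/π)²`). [cite: LSSY2005, Ch. 5 (5.15)–(5.17)] -/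
theorem stub_blockMassCapture : ∀ (N : ℕ) (L : ℝ) (Ψ : TrialState N L) (K : ℕ),
    (N : ℝ≥0∞) ≤ (∑ i : Fin 3 → Fin (2 ^ K), occupation N (dyMode L K i) Ψ.ψ) +
      ENNReal.ofReal ((L / 2 ^ K) ^ 2 / Real.pi ^ 2) * ∫⁻ X, kineticDensity Ψ.ψ X := by
  intro N L Ψ K
  cases N with
  | zero => simp
  | succ n =>
    have hL : 0 < L := blockMassCapture_side_pos Ψ
    have hmode : ∀ q : Fin 3 → Fin (2 ^ K), subMode (L / 2 ^ K) q = dyMode L K q :=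
      blockMassCapture_subMode_eq_dyMode L K
    set ℓ : ℝ := L / 2 ^ K with hℓ
    have hℓ0 : 0 < ℓ := by positivity
    have hkℓ : ((2 ^ K : ℕ) : ℝ) * ℓ = L := by
      rw [hℓ]; push_cast; field_simp
    have henergy : energy 0 Ψ = ∫⁻ X, kineticDensity Ψ.ψ X := by
      simp only [energy, interaction_zeroPotential, zero_mul, add_zero]
    have hkey := key_inequality (k := 2 ^ K) hℓ0 hkℓ Ψ
    simp only [hmode, henergy] at hkey
    set C : ℝ≥0∞ := ENNReal.ofReal ((Real.pi / ℓ) ^ 2) with hC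
    set D : ℝ≥0∞ := ENNReal.ofReal (ℓ ^ 2 / Real.pi ^ 2) with hD
    have hDC : D * C = 1 := by
      rw [hD, hC, ← ENNReal.ofReal_mul (by positivity), ← ENNReal.ofReal_one]
      congr 1
      field_simp
    have hcast : ((n + 1 : ℕ) : ℝ≥0∞) = (n + 1 : ℝ≥0∞) := Nat.cast_succ n
    calc ((n + 1 : ℕ) : ℝ≥0∞) = D * (C * (n + 1 : ℝ≥0∞)) := by
          rw [← mul_assoc, hDC, one_mul, hcast]
      _ ≤ D * ((∫⁻ X, kineticDensity Ψ.ψ X) +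
          C * ∑ q : Fin 3 → Fin (2 ^ K), occupation (n + 1) (dyMode L K q) Ψ.ψ) := by
          gcongr
      _ = _ := by rw [mul_add, ← mul_assoc, hDC, one_mul, add_comm]

end Summit.AtomisticToContinuum.BoseEinsteinCondensation.Theorems.BaseCoherentMass

end
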